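import Summits.Ventures.PackingBounds.Energy.FivePointCubic
import Summits.Ventures.PackingBounds.Energy.ThreePointEnergyDeficit
import Summits.Ventures.PackingBounds.Energy.FivePointBipyramidRigidity
import HarnessLib

/-!
# Five points on `S²`, potential `(1+⟪x,y⟫)³`: every minimiser is a triangular bipyramid (rigidity from the SOS face)

Framing: lottery ticket; floor = certified bounds/negative ranges. Venture `PackingBounds`, cell
`pub-packcert`, energy family E3PT (pub-packcert-energy gen 13; the gen-12 SOS-face recipe on the gen-10
'Squares' layout of the `(1+t)³` certificate).

If five unit vectors `C ⊂ ℝ³` attain `Σ_{x≠y} (1+⟪x,y⟫)³ = 51/4`, then by the deficit identity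
(`ThreePointDeficit.energy_sub_bound_eq`) the slack of the three-point inequality vanishes at every ordered
triple of distinct points; the slack is the explicit weighted sum of squares `FivePointCubic.sosR`
(`cubic_sos_identity`), whose diagonal part `dgPart` contains `δ·(t + 3t² + 2t³)²` with `δ > 0`, so the face
polynomial `t(t+1)(2t+1)` vanishes at every inner product `t = ⟪y,z⟫`: all inner products lie in
`{0, -1, -1/2}`; `Σ x = 0` from `a₁ > 0`; hence `C` is a triangular bipyramid (`Bipyramid5.rigid`).
-/

noncomputable section

open Finset
open scoped RealInnerProductSpace

namespace Summit.Ventures.PackingBounds.Energy.FivePointCubic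

open Literature.Geometry.DiscreteGeometry Literature.Geometry.DiscreteGeometry.BachocVallentin
open Literature.Analysis.SpecialFunctions

/-- The two-point multiplier is strictly positive. -/
theorem cubic_a1_pos : 0 < FivePointCubic.a1 := by unfold FivePointCubic.a1; norm_num

/-- **Margin of the diagonal part:** `δ·(t + 3t² + 2t³)² ≤ dgPart u v t` (all other terms are nonnegatively weighted squares). -/
theorem cubic_dgPart_ge (u v t : ℝ) :
    ((1421168414977 : ℝ)/1583296743997440) * ((1 : ℝ) * t + (3 : ℝ) * t^2 + (2 : ℝ) * t^3)^2 ≤ FivePointCubic.dgPart u v t := by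
  have g1 : (0:ℝ) ≤ ((1973865181 : ℝ)/8796093022208) * (((-3) : ℝ) * t + ((-7) : ℝ) * t^2 + (4 : ℝ) * t^4)^2 := by positivity
  have g2 : (0:ℝ) ≤ ((1421124512743 : ℝ)/1583296743997440) * ((1 : ℝ) * v * t + (2 : ℝ) * v * t^2)^2 := by positivity
  have g3 : (0:ℝ) ≤ ((63163729815 : ℝ)/281474976710656) * (((-1) : ℝ) * v * t + (4 : ℝ) * v * t^3)^2 := by positivity
  have g4 : (0:ℝ) ≤ ((2842173382651 : ℝ)/3166593487994880) * ((1 : ℝ) * v * t + (2 : ℝ) * v^2 * t)^2 := by positivity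
  have g5 : (0:ℝ) ≤ ((63153584975 : ℝ)/281474976710656) * (((-1) : ℝ) * v * t + (4 : ℝ) * v^2 * t^2)^2 := by positivity
  have g6 : (0:ℝ) ≤ ((2842320688313 : ℝ)/3166593487994880) * ((1 : ℝ) * v + (3 : ℝ) * v^2 + (2 : ℝ) * v^3)^2 := by positivity
  have g7 : (0:ℝ) ≤ ((63162801913 : ℝ)/281474976710656) * (((-1) : ℝ) * v * t + (4 : ℝ) * v^3 * t)^2 := by positivity
  have g8 : (0:ℝ) ≤ ((63155813295 : ℝ)/281474976710656) * (((-3) : ℝ) * v + ((-7) : ℝ) * v^2 + (4 : ℝ) * v^4)^2 := by positivity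
  have g9 : (0:ℝ) ≤ ((2842194692843 : ℝ)/791648371998720) * (((-1) : ℝ) * v * t + (1 : ℝ) * u * t)^2 := by positivity
  have g10 : (0:ℝ) ≤ ((63159194713 : ℝ)/70368744177664) * ((1 : ℝ) * v * t + (2 : ℝ) * u * t^2)^2 := by positivity
  have g11 : (0:ℝ) ≤ ((63159939919 : ℝ)/281474976710656) * (((-1) : ℝ) * v * t + (4 : ℝ) * u * t^3)^2 := by positivity
  have g12 : (0:ℝ) ≤ ((1421080190083 : ℝ)/395824185999360) * (((-1) : ℝ) * v * t + (1 : ℝ) * u * v)^2 := by positivity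
  have g13 : (0:ℝ) ≤ ((63155602551 : ℝ)/70368744177664) * ((1 : ℝ) * v * t + (2 : ℝ) * u * v * t)^2 := by positivity
  have g14 : (0:ℝ) ≤ ((31581159339 : ℝ)/140737488355328) * (((-1) : ℝ) * v * t + (4 : ℝ) * u * v * t^2)^2 := by positivity
  have g15 : (0:ℝ) ≤ ((31576469619 : ℝ)/35184372088832) * ((1 : ℝ) * v * t + (2 : ℝ) * u * v^2)^2 := by positivity
  have g16 : (0:ℝ) ≤ ((31579229859 : ℝ)/140737488355328) * (((-1) : ℝ) * v * t + (4 : ℝ) * u * v^2 * t)^2 := by positivity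
  have g17 : (0:ℝ) ≤ ((63158261049 : ℝ)/281474976710656) * (((-1) : ℝ) * v * t + (4 : ℝ) * u * v^3)^2 := by positivity
  have g18 : (0:ℝ) ≤ ((947323307239 : ℝ)/1055531162664960) * ((1 : ℝ) + (3 : ℝ) * t + (2 : ℝ) * t^2 + (3 : ℝ) * v + (8 : ℝ) * v * t + (2 : ℝ) * v^2 + (3 : ℝ) * u + (2 : ℝ) * u^2)^2 := by positivity
  have g19 : (0:ℝ) ≤ ((15789772821 : ℝ)/17592186044416) * ((1 : ℝ) * v * t + (2 : ℝ) * u^2 * t)^2 := by positivity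
  have g20 : (0:ℝ) ≤ ((63161529345 : ℝ)/281474976710656) * (((-1) : ℝ) * v * t + (4 : ℝ) * u^2 * t^2)^2 := by positivity
  have g21 : (0:ℝ) ≤ ((2842263822691 : ℝ)/3166593487994880) * ((1 : ℝ) * v * t + (2 : ℝ) * u^2 * v)^2 := by positivity
  have g22 : (0:ℝ) ≤ ((31576738387 : ℝ)/140737488355328) * (((-1) : ℝ) * v * t + (4 : ℝ) * u^2 * v * t)^2 := by positivity
  have g23 : (0:ℝ) ≤ ((63155436679 : ℝ)/281474976710656) * (((-1) : ℝ) * v * t + (4 : ℝ) * u^2 * v^2)^2 := by positivity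
  have g24 : (0:ℝ) ≤ ((31581631537 : ℝ)/140737488355328) * (((-3) : ℝ) + ((-9) : ℝ) * t + ((-6) : ℝ) * t^2 + ((-9) : ℝ) * v + ((-24) : ℝ) * v * t + ((-6) : ℝ) * v^2 + ((-7) : ℝ) * u + (4 : ℝ) * u^3)^2 := by positivity
  have g25 : (0:ℝ) ≤ ((15790818437 : ℝ)/70368744177664) * (((-1) : ℝ) * v * t + (4 : ℝ) * u^3 * t)^2 := by positivity
  have g26 : (0:ℝ) ≤ ((3947560905 : ℝ)/17592186044416) * (((-1) : ℝ) * v * t + (4 : ℝ) * u^3 * v)^2 := by positivity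
  have g27 : (0:ℝ) ≤ ((15789450651 : ℝ)/281474976710656) * ((7 : ℝ) + (21 : ℝ) * t + (14 : ℝ) * t^2 + (21 : ℝ) * v + (56 : ℝ) * v * t + (14 : ℝ) * v^2 + (15 : ℝ) * u + (8 : ℝ) * u^4)^2 := by positivity
  unfold FivePointCubic.dgPart
  linarith [g1, g2, g3, g4, g5, g6, g7, g8, g9, g10, g11, g12, g13, g14, g15, g16, g17, g18, g19, g20, g21, g22, g23, g24, g25, g26, g27]

/-- If the weighted sum of squares `sosR` vanishes, the face polynomial `t + 3t² + 2t³ = t(t+1)(2t+1)` vanishes: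
`t ∈ {0, -1, -1/2}`. -/
theorem t_of_sosR_eq_zero (u v t : ℝ) (h : FivePointCubic.sosR u v t = 0) : t = 0 ∨ t = -1 ∨ t = -1 / 2 := by
  have hdg : FivePointCubic.dgPart u v t = 0 := by
    have e : FivePointCubic.sosR u v t = FivePointCubic.sqPart0 u v t + FivePointCubic.sqPart1 u v t + FivePointCubic.sqPart2 u v t
        + FivePointCubic.sqPart3 u v t + FivePointCubic.prPart0 u v t + FivePointCubic.prPart1 u v t + FivePointCubic.prPart2 u v t
        + FivePointCubic.prPart3 u v t + FivePointCubic.prPart4 u v t + FivePointCubic.prPart5 u v t + FivePointCubic.prPart6 u v t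
        + FivePointCubic.prPart7 u v t + FivePointCubic.prPart8 u v t + FivePointCubic.dgPart u v t := rfl
    linarith [cubic_sqPart0_nonneg u v t, cubic_sqPart1_nonneg u v t, cubic_sqPart2_nonneg u v t, cubic_sqPart3_nonneg u v t,
      cubic_prPart0_nonneg u v t, cubic_prPart1_nonneg u v t, cubic_prPart2_nonneg u v t, cubic_prPart3_nonneg u v t,
      cubic_prPart4_nonneg u v t, cubic_prPart5_nonneg u v t, cubic_prPart6_nonneg u v t, cubic_prPart7_nonneg u v t,
      cubic_prPart8_nonneg u v t, cubic_dgPart_nonneg u v t]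
  have hm := cubic_dgPart_ge u v t
  rw [hdg] at hm
  have hz : (1 : ℝ) * t + (3 : ℝ) * t ^ 2 + (2 : ℝ) * t ^ 3 = 0 := by
    nlinarith [sq_nonneg ((1 : ℝ) * t + (3 : ℝ) * t ^ 2 + (2 : ℝ) * t ^ 3)]
  have hf : t * (t + 1) * (2 * t + 1) = 0 := by linear_combination hz
  rcases mul_eq_zero.1 hf with h' | h'
  · rcases mul_eq_zero.1 h' with h'' | h''
    · left; exact h''
    · right; left; linarith
  · right; right; linarith

/-- **Rigidity of the `(1+t)³`-energy ground state of five points.** If five unit vectors of `ℝ³` attain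
`Σ_{x≠y} (1+⟪x,y⟫)³ = 51/4`, then all inner products of distinct points lie in `{-1, 0, -1/2}`, `Σ x = 0`,
and the configuration is a triangular bipyramid. -/
theorem ck3_five_points_rigid (C : Finset (EuclideanSpace ℝ (Fin 3))) (hC : ∀ x ∈ C, ‖x‖ = 1)
    (h5 : C.card = 5)
    (hmin : ∑ x ∈ C, ∑ y ∈ C.erase x, (1 + inner ℝ x y) ^ 3 = 51 / 4) :
    (∀ x ∈ C, ∀ y ∈ C, x ≠ y → inner ℝ x y = -1 ∨ inner ℝ x y = 0 ∨ inner ℝ x y = -1 / 2)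
    ∧ (∑ x ∈ C, x = 0)
    ∧ ∃ p ∈ C, -p ∈ C ∧ (∀ z ∈ C, z ≠ p → z ≠ -p → inner ℝ z p = 0)
        ∧ (∀ z ∈ C, ∀ w ∈ C, z ≠ p → z ≠ -p → w ≠ p → w ≠ -p → z ≠ w → inner ℝ z w = -1 / 2) := by
  classical
  have hA := pairSum_gegenbauer_comb_nonneg (n := 3) (by norm_num) 1 aco3 cubic_aco_nonneg C hC
  have hF := tripleSum_threePointF3_nonneg 4 4 dco3 cubic_dco_nonneg gw3 C hC
  have hcard : (C.card : ℝ) = 5 := by exact_mod_cast h5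
  have hAeval : ∀ w : ℝ, (∑ k ∈ range (1 + 1), aco3 k * gegenbauerSum ((((3 : ℕ) : ℝ) - 2) / 2) k w)
      = FivePointCubic.a1 * w := by
    intro w
    have h0 : aco3 0 = 0 := rfl
    have h1 : aco3 1 = FivePointCubic.a1 := rfl
    simp only [Finset.sum_range_succ, Finset.sum_range_zero, h0, h1, gegenbauerSum_one, gegenbauerSum_zero]
    push_cast
    ring
  have hineq : ∀ u v t : ℝ, -1 ≤ u → u < 1 → -1 ≤ v → v < 1 → -1 ≤ t → t < 1 →
      0 ≤ 1 + 2 * u * v * t - u ^ 2 - v ^ 2 - t ^ 2 →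
      FivePointCubic.c0 + ((C.card : ℝ) - 2) * threePointF3 4 4 dco3 gw3 u v t + threePointF3 4 4 dco3 gw3 u u 1
        + threePointF3 4 4 dco3 gw3 v v 1 + threePointF3 4 4 dco3 gw3 t t 1
        + ((fun w => ∑ k ∈ range (1 + 1), aco3 k * gegenbauerSum ((((3 : ℕ) : ℝ) - 2) / 2) k w) u
          + (fun w => ∑ k ∈ range (1 + 1), aco3 k * gegenbauerSum ((((3 : ℕ) : ℝ) - 2) / 2) k w) v
          + (fun w => ∑ k ∈ range (1 + 1), aco3 k * gegenbauerSum ((((3 : ℕ) : ℝ) - 2) / 2) k w) t) / 3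
        ≤ (FivePointCubic.pmin u + FivePointCubic.pmin v + FivePointCubic.pmin t) / 3 := by
    intro u v t hu1 hu2 hv1 hv2 ht1 ht2 hdet
    simp only [hAeval, hcard, cubic_threePointF3_eq]
    have h1 := cubic_sos_identity u v t
    have h2 := cubic_sosR_nonneg u v t
    linarith
  -- the energy in terms of `pmin`
  have hEp : ∑ x ∈ C, ∑ y ∈ C.erase x, FivePointCubic.pmin (inner ℝ x y) = 51 / 4 := by
    rw [← hmin]
    refine Finset.sum_congr rfl fun x _ => Finset.sum_congr rfl fun y _ => ?_
    simp only [FivePointCubic.pmin]; ring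
  have hb : (5 : ℝ) * ((5 - 1) * FivePointCubic.c0 - FivePointCubic.Fexp 1 1 1 - FivePointCubic.a1 * 1) = (51 : ℝ) / 4 := by
    norm_num [FivePointCubic.c0, FivePointCubic.Fexp, FivePointCubic.a1]
  have hsharp : ∑ x ∈ C, ∑ y ∈ C.erase x, FivePointCubic.pmin (inner ℝ x y)
      = (C.card : ℝ) * (((C.card : ℝ) - 1) * FivePointCubic.c0 - threePointF3 4 4 dco3 gw3 1 1 1
        - (fun w => ∑ k ∈ range (1 + 1), aco3 k * gegenbauerSum ((((3 : ℕ) : ℝ) - 2) / 2) k w) 1) := by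
    simp only [hAeval, hcard, cubic_threePointF3_eq]
    rw [hEp, hb]
  obtain ⟨hA0, hF0⟩ := ThreePointDeficit.pairSum_eq_zero_of_sharp C hC (by omega) FivePointCubic.pmin _ _ FivePointCubic.c0 hA hF
    (threePointF3_swap12 4 4 dco3 gw3) (threePointF3_swap23 4 4 dco3 gw3) hineq hsharp
  -- the triple-slack sum vanishes
  have hid := ThreePointDeficit.energy_sub_bound_eq C hC (by omega) FivePointCubic.pmin
    (fun w => ∑ k ∈ range (1 + 1), aco3 k * gegenbauerSum ((((3 : ℕ) : ℝ) - 2) / 2) k w)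
    (threePointF3 4 4 dco3 gw3) FivePointCubic.c0
    (threePointF3_swap12 4 4 dco3 gw3) (threePointF3_swap23 4 4 dco3 gw3)
  rw [hsharp, sub_self, hA0, hF0, add_zero, add_zero] at hid
  -- every term of the triple sum is ≥ 0
  have hrange : ∀ x ∈ C, ∀ y ∈ C, x ≠ y → -1 ≤ inner ℝ x y ∧ inner ℝ x y < 1 := by
    intro x hx y hy hxy
    refine ⟨neg_one_le_real_inner_of_norm_eq_one (hC x hx) (hC y hy),
      lt_of_le_of_ne (real_inner_le_one_of_norm_eq_one (hC x hx) (hC y hy)) ?_⟩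
    intro h1
    exact hxy ((inner_eq_one_iff_of_norm_eq_one (𝕜 := ℝ) (hC x hx) (hC y hy)).1 h1)
  set T : EuclideanSpace ℝ (Fin 3) → EuclideanSpace ℝ (Fin 3) → EuclideanSpace ℝ (Fin 3) → ℝ :=
    fun x y z => ((FivePointCubic.pmin (inner ℝ x y) + FivePointCubic.pmin (inner ℝ x z) + FivePointCubic.pmin (inner ℝ y z))
        - (3 * FivePointCubic.c0 + 3 * (((C.card : ℝ) - 2) * threePointF3 4 4 dco3 gw3 (inner ℝ x y) (inner ℝ x z) (inner ℝ y z))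
          + 3 * (threePointF3 4 4 dco3 gw3 (inner ℝ x y) (inner ℝ x y) 1
            + threePointF3 4 4 dco3 gw3 (inner ℝ x z) (inner ℝ x z) 1
            + threePointF3 4 4 dco3 gw3 (inner ℝ y z) (inner ℝ y z) 1)
          + ((fun w => ∑ k ∈ range (1 + 1), aco3 k * gegenbauerSum ((((3 : ℕ) : ℝ) - 2) / 2) k w) (inner ℝ x y)
            + (fun w => ∑ k ∈ range (1 + 1), aco3 k * gegenbauerSum ((((3 : ℕ) : ℝ) - 2) / 2) k w) (inner ℝ x z)
            + (fun w => ∑ k ∈ range (1 + 1), aco3 k * gegenbauerSum ((((3 : ℕ) : ℝ) - 2) / 2) k w) (inner ℝ y z))))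
    with hTdef
  have hTnn : ∀ x ∈ C, ∀ y ∈ C.erase x, ∀ z ∈ (C.erase x).erase y, 0 ≤ T x y z := by
    intro x hx y hy z hz
    have hyC : y ∈ C := Finset.mem_of_mem_erase hy
    have hxy : x ≠ y := fun h => (Finset.ne_of_mem_erase hy) h.symm
    have hz1 : z ∈ C.erase x := Finset.mem_of_mem_erase hz
    have hzC : z ∈ C := Finset.mem_of_mem_erase hz1
    have hzy : z ≠ y := Finset.ne_of_mem_erase hz
    have hzx : z ≠ x := Finset.ne_of_mem_erase hz1
    obtain ⟨lo1, hi1⟩ := hrange x hx y hyC hxy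
    obtain ⟨lo2, hi2⟩ := hrange x hx z hzC hzx.symm
    obtain ⟨lo3, hi3⟩ := hrange y hyC z hzC hzy.symm
    have h0 := hineq _ _ _ lo1 hi1 lo2 hi2 lo3 hi3
      (BachocVallentin.gram3_nonneg x y z (hC x hx) (hC y hyC) (hC z hzC))
    simp only [hTdef]
    linarith
  have hSum0 : ∑ x ∈ C, ∑ y ∈ C.erase x, ∑ z ∈ (C.erase x).erase y, T x y z = 0 := by
    have hpos : (0 : ℝ) < 1 / (3 * ((C.card : ℝ) - 2)) := by rw [hcard]; norm_num
    have h := hid.symm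
    simp only [hTdef]
    rcases mul_eq_zero.1 h with h1 | h1
    · exact absurd h1 hpos.ne'
    · exact h1
  have hT0 : ∀ x ∈ C, ∀ y ∈ C.erase x, ∀ z ∈ (C.erase x).erase y, T x y z = 0 := by
    have h1 := (Finset.sum_eq_zero_iff_of_nonneg (fun x hx =>
      Finset.sum_nonneg fun y hy => Finset.sum_nonneg fun z hz => hTnn x hx y hy z hz)).1 hSum0
    intro x hx
    have h2 := (Finset.sum_eq_zero_iff_of_nonneg (fun y hy =>
      Finset.sum_nonneg fun z hz => hTnn x hx y hy z hz)).1 (h1 x hx)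
    intro y hy
    exact (Finset.sum_eq_zero_iff_of_nonneg (fun z hz => hTnn x hx y hy z hz)).1 (h2 y hy)
  -- value set: for distinct y, z pick a third point x and read off the face polynomial
  have hvals : ∀ y ∈ C, ∀ z ∈ C, y ≠ z → inner ℝ y z = -1 ∨ inner ℝ y z = 0 ∨ inner ℝ y z = -1 / 2 := by
    intro y hy z hz hyz
    have hcard3 : 0 < ((C.erase y).erase z).card := by
      rw [Finset.card_erase_of_mem (Finset.mem_erase.2 ⟨fun h => hyz h.symm, hz⟩),
        Finset.card_erase_of_mem hy, h5]; norm_num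
    obtain ⟨x, hx⟩ := Finset.card_pos.1 hcard3
    have hx1 : x ∈ C.erase y := Finset.mem_of_mem_erase hx
    have hxC : x ∈ C := Finset.mem_of_mem_erase hx1
    have hxz : x ≠ z := Finset.ne_of_mem_erase hx
    have hxy : x ≠ y := Finset.ne_of_mem_erase hx1
    have hy' : y ∈ C.erase x := Finset.mem_erase.2 ⟨fun h => hxy h.symm, hy⟩
    have hz' : z ∈ (C.erase x).erase y := Finset.mem_erase.2 ⟨fun h => hyz h.symm, Finset.mem_erase.2 ⟨fun h => hxz h.symm, hz⟩⟩
    have hT := hT0 x hxC y hy' z hz'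
    simp only [hTdef, hAeval, hcard, cubic_threePointF3_eq] at hT
    set u := inner ℝ x y with hu
    set v := inner ℝ x z with hv
    set t := inner ℝ y z with ht
    have hre := cubic_sos_identity u v t
    have g0 := cubic_sosR_nonneg u v t
    have hq0 : FivePointCubic.sosR u v t = 0 := by linarith [hT, hre, g0]
    rcases t_of_sosR_eq_zero u v t hq0 with h | h | h
    · right; left; exact h
    · left; exact h
    · right; right; exact h
  -- balanced
  have hfun : (fun w => ∑ k ∈ range (1 + 1), aco3 k * gegenbauerSum ((((3 : ℕ) : ℝ) - 2) / 2) k w)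
      = fun t => FivePointCubic.a1 * t := funext hAeval
  rw [hfun] at hA0
  have hsum0 : ∑ x ∈ C, x = 0 := ThreePointDeficit.sum_eq_zero_of_sharp C FivePointCubic.a1 cubic_a1_pos hA0
  exact ⟨hvals, hsum0, Bipyramid5.rigid C hC h5 hsum0 hvals⟩

end Summit.Ventures.PackingBounds.Energy.FivePointCubic
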